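import Literature.MathematicalPhysics.StatisticalMechanics.FccWulffBodyHull
import Summits.Ventures.Crystal3D.Theorems.StickyWulffConstantPolycrystalWulffBoundChordFlip

/-!
# `PolycrystalWulffBound`, line `PolyDensity`: the truncated octahedron in the cubic frame — symmetries
# and the CAP REFLECTION along the three `⟨112⟩` zones (kernel route to `TwinSectionShift (1/√6)`,
# crux `stmt-Ventures-19482`)

Route `StickyWulffConstant` of the venture `Summits/Ventures/Crystal3D`, second prover lane (poly-p2,
gen 9).  For the fcc Wulff body `W = conv{perm(0,±1,±2)} = {‖y‖_∞ ≤ 2, ‖y‖₁ ≤ 3}`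
(`Literature.….fccWulffBody`) this file supplies the body-specific inputs of the chord-flip proof
(`…ChordFlip.lean`) that the cumulative section volumes of `W` and of its twin `R_{[111]} W` along any
unit normal `n` are shifts of each other by at most `sin∠(n,[111])/√6` (the theorem itself is
`fccWulffBody_twin_cdf_le`, `…TwinSectionShiftCubicTwin.lean`):
* `volume_image_inter_halfSpace` — `|T K ∩ {⟪x,μ⟫ < s}| = |K ∩ {⟪x, T⁻¹μ⟫ < s}|` for a linear isometry
  `T` (used with the twin mirror, `−1`, and the `{1 -1 0}` mirrors);
* `reflection_orthogonal_apply_div` — `R_u v = v − (2⟪u,v⟫/‖u‖²) u`;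
* `neg_image_fccWulffBody`, `reflection_swap_apply`, `reflection_swap_image_fccWulffBody` — `W = −W`
  and the `{1 -1 0}` mirrors of the cubic frame are coordinate swaps preserving `W`;
* `volume_inter_lt_reflect_le_of_cap_div` — the chord flip of `…ChordFlip.lean` for a non-normalised
  mirror direction `d` (`‖d‖² = N`);
* `cap_reflect_arith`, `cap_reflect_mem_fccWulffBody₀/₁/₂` — **the cap `W ∩ {⟪x, d_k⟫ ≥ 1}`,
  `d_k ∈ {(−2,1,1), (1,−2,1), (1,1,−2)}`, reflected across its base plane `{⟪x, d_k⟫ = 1}`, lies in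
  `W`** (so every chord of `W` parallel to `d_k` has its midpoint in the slab `|⟪x, d_k⟫| ≤ 1`, i.e.
  `|⟪x, d_k/√6⟫| ≤ 1/√6` — the source of the constant `1/√6`); pure linear arithmetic on the
  cube ∩ octahedron (`mem_fccWulffBody_iff`), each facet inequality of the image closed by `linarith`.
WHAT THIS IS NOT: the section-shift theorem (next file) or its crux-vocabulary form
`TwinSectionShift (1/√6)`; the crux is not claimed. -/

noncomputable section

open scoped BigOperators InnerProductSpace ENNReal
open MeasureTheory Set

namespace Summit.Ventures.Crystal3D.Theorems

open Summit.Ventures.Crystal3D.Cruxes.TextureLiminf.TexShadow (E3)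
open Literature.MathematicalPhysics.StatisticalMechanics (fccWulffBody mem_fccWulffBody_iff
  isCompact_fccWulffBody convex_fccWulffBody)

/-! ### Half-space sections under linear isometries -/

/-- `T K ∩ {⟪x, μ⟫ < s} = T (K ∩ {⟪x, T⁻¹ μ⟫ < s})` for a linear isometry `T`. -/
theorem image_inter_halfSpace_eq (T : E3 ≃ₗᵢ[ℝ] E3) (K : Set E3) (μ : E3) (s : ℝ) :
    T '' K ∩ {x : E3 | ⟪x, μ⟫_ℝ < s} = T '' (K ∩ {x : E3 | ⟪x, T.symm μ⟫_ℝ < s}) := by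
  have hT : ∀ y : E3, ⟪T y, μ⟫_ℝ = ⟪y, T.symm μ⟫_ℝ := fun y => by
    rw [← T.inner_map_map y (T.symm μ), T.apply_symm_apply]
  ext x
  constructor
  · rintro ⟨⟨y, hy, rfl⟩, hx⟩
    exact ⟨y, ⟨hy, by simpa only [mem_setOf_eq, hT] using hx⟩, rfl⟩
  · rintro ⟨y, ⟨hy, hyμ⟩, rfl⟩
    exact ⟨⟨y, hy, rfl⟩, by simpa only [mem_setOf_eq, hT] using hyμ⟩

/-- **Volumes of half-space sections are isometry-covariant**:
`|T K ∩ {⟪x, μ⟫ < s}| = |K ∩ {⟪x, T⁻¹ μ⟫ < s}|`. -/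
theorem volume_image_inter_halfSpace (T : E3 ≃ₗᵢ[ℝ] E3) {K : Set E3} (hK : MeasurableSet K)
    (μ : E3) (s : ℝ) :
    volume (T '' K ∩ {x : E3 | ⟪x, μ⟫_ℝ < s}) = volume (K ∩ {x : E3 | ⟪x, T.symm μ⟫_ℝ < s}) := by
  have hm : MeasurableSet (K ∩ {x : E3 | ⟪x, T.symm μ⟫_ℝ < s}) :=
    hK.inter (isOpen_lt (continuous_id.inner continuous_const) continuous_const).measurableSet
  rw [image_inter_halfSpace_eq, LinearIsometryEquiv.image_eq_preimage_symm,
    T.symm.measurePreserving.measure_preimage hm.nullMeasurableSet]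

/-- The mirror across the plane orthogonal to `u`: `R_u v = v − (2⟪u,v⟫/‖u‖²) u`. -/
theorem reflection_orthogonal_apply_div (u v : E3) :
    (ℝ ∙ u)ᗮ.reflection v = v - (2 * ⟪u, v⟫_ℝ / ‖u‖ ^ 2) • u := by
  rw [Submodule.reflection_orthogonal_apply, Submodule.reflection_singleton_apply]
  simp only [RCLike.ofReal_real_eq_id, id_eq, neg_sub]
  rw [two_smul, ← add_smul]
  congr 1
  ring

/-! ### Symmetries of the cubic Wulff body -/

/-- `W = −W`. -/
theorem neg_mem_fccWulffBody {y : E3} (hy : y ∈ fccWulffBody) : -y ∈ fccWulffBody := by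
  rw [mem_fccWulffBody_iff] at hy ⊢
  refine ⟨fun i => ?_, ?_⟩
  · rw [PiLp.neg_apply, abs_neg]; exact hy.1 i
  · simpa only [PiLp.neg_apply, abs_neg] using hy.2

/-- `(−1) '' W = W`. -/
theorem neg_image_fccWulffBody :
    (LinearIsometryEquiv.neg ℝ : E3 ≃ₗᵢ[ℝ] E3) '' fccWulffBody = fccWulffBody := by
  ext y
  constructor
  · rintro ⟨x, hx, rfl⟩
    exact neg_mem_fccWulffBody hx
  · intro hy
    exact ⟨-y, neg_mem_fccWulffBody hy, neg_neg y⟩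

/-- The `{1 -1 0}` mirrors of the cubic frame are coordinate swaps:
`R_{e_i − e_j} x = x ∘ swap(i, j)`. -/
theorem reflection_swap_apply {i j : Fin 3} (hij : i ≠ j) (x : E3) (l : Fin 3) :
    (ℝ ∙ (EuclideanSpace.single i (1 : ℝ) - EuclideanSpace.single j (1 : ℝ)))ᗮ.reflection x l =
      x (Equiv.swap i j l) := by
  set v : E3 := EuclideanSpace.single i (1 : ℝ) - EuclideanSpace.single j (1 : ℝ) with hv
  have hvx : ⟪v, x⟫_ℝ = x i - x j := by
    rw [hv, inner_sub_left, EuclideanSpace.inner_single_left, EuclideanSpace.inner_single_left]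
    simp
  have hvv : ‖v‖ ^ 2 = 2 := by
    rw [← real_inner_self_eq_norm_sq, hv, inner_sub_left, inner_sub_right, inner_sub_right,
      EuclideanSpace.inner_single_left, EuclideanSpace.inner_single_left,
      EuclideanSpace.inner_single_left, EuclideanSpace.inner_single_left]
    simp [hij, hij.symm]
    norm_num
  rw [reflection_orthogonal_apply_div, hvx, hvv]
  have hcoef : 2 * (x i - x j) / 2 = x i - x j := by ring
  have hvl : v l = (if l = i then 1 else 0) - (if l = j then 1 else 0) := by
    rw [hv, PiLp.sub_apply]
    simp
  rw [hcoef, PiLp.sub_apply, PiLp.smul_apply, hvl, smul_eq_mul]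
  by_cases hli : l = i
  · subst hli
    rw [if_pos rfl, if_neg hij, Equiv.swap_apply_left]
    ring
  · by_cases hlj : l = j
    · subst hlj
      rw [if_neg hli, if_pos rfl, Equiv.swap_apply_right]
      ring
    · rw [if_neg hli, if_neg hlj, Equiv.swap_apply_of_ne_of_ne hli hlj]
      ring

/-- The `{1 -1 0}` mirrors preserve the cubic Wulff body (pointwise). -/
theorem reflection_swap_mem_fccWulffBody {i j : Fin 3} (hij : i ≠ j) {x : E3} (hx : x ∈ fccWulffBody) :
    (ℝ ∙ (EuclideanSpace.single i (1 : ℝ) - EuclideanSpace.single j (1 : ℝ)))ᗮ.reflection x ∈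
      fccWulffBody := by
  rw [mem_fccWulffBody_iff] at hx ⊢
  refine ⟨fun l => ?_, ?_⟩
  · rw [reflection_swap_apply hij]; exact hx.1 _
  · simp only [reflection_swap_apply hij]
    rw [Equiv.sum_comp (Equiv.swap i j) (fun l => |x l|)]
    exact hx.2

/-- The `{1 -1 0}` mirrors preserve the cubic Wulff body (as an image). -/
theorem reflection_swap_image_fccWulffBody {i j : Fin 3} (hij : i ≠ j) :
    (ℝ ∙ (EuclideanSpace.single i (1 : ℝ) - EuclideanSpace.single j (1 : ℝ)))ᗮ.reflection ''
      fccWulffBody = fccWulffBody := by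
  set R := (ℝ ∙ (EuclideanSpace.single i (1 : ℝ) - EuclideanSpace.single j (1 : ℝ)))ᗮ.reflection
  ext y
  constructor
  · rintro ⟨x, hx, rfl⟩
    exact reflection_swap_mem_fccWulffBody hij hx
  · intro hy
    exact ⟨R y, reflection_swap_mem_fccWulffBody hij hy, Submodule.reflection_reflection _ y⟩

/-! ### The chord flip along a non-normalised direction -/

/-- The chord flip `volume_inter_lt_reflect_le_of_cap` with the mirror direction given by any vector `d`
with `‖d‖² = N > 0`: if the cap `K ∩ {⟪x, d⟫ ≥ ℓ}` reflects into `K`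
(`x − (2(⟪x,d⟫ − ℓ)/N) d ∈ K`), then `|K ∩ {⟪x, ν − (2⟪d,ν⟫/N) d⟫ < t}| ≤ |K ∩ {⟪x, ν⟫ < t + δ}|` for
`δ ≥ 2 ℓ |⟪d, ν⟫| / N`. -/
theorem volume_inter_lt_reflect_le_of_cap_div {K : Set E3} (hKc : Convex ℝ K) (hK : IsCompact K)
    (hKs : ∀ x ∈ K, -x ∈ K) {d : E3} {N : ℝ} (hN : ‖d‖ ^ 2 = N) (hN0 : 0 < N) {ℓ : ℝ}
    (hcap : ∀ x ∈ K, ℓ ≤ ⟪x, d⟫_ℝ → x - (2 * (⟪x, d⟫_ℝ - ℓ) / N) • d ∈ K)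
    (ν : E3) (t : ℝ) {δ : ℝ} (hδ : 2 * ℓ * |⟪d, ν⟫_ℝ| / N ≤ δ) :
    volume (K ∩ {x : E3 | ⟪x, ν - (2 * ⟪d, ν⟫_ℝ / N) • d⟫_ℝ < t}) ≤
      volume (K ∩ {x : E3 | ⟪x, ν⟫_ℝ < t + δ}) := by
  have hr : 0 < ‖d‖ := by
    rcases (norm_nonneg d).eq_or_lt with h | h
    · exfalso
      rw [← h] at hN
      rw [← hN] at hN0
      norm_num at hN0
    · exact h
  set r := ‖d‖ with hr_def
  have hrN : r * r = N := by rw [← hN, sq]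
  set e : E3 := r⁻¹ • d with he_def
  have he : ‖e‖ = 1 := by
    rw [he_def, norm_smul, Real.norm_eq_abs, abs_inv, abs_of_pos hr, inv_mul_cancel₀ hr.ne']
  have hinner_e : ∀ y : E3, ⟪y, e⟫_ℝ = r⁻¹ * ⟪y, d⟫_ℝ := fun y => by
    rw [he_def, real_inner_smul_right]
  have hinner_e' : ∀ y : E3, ⟪e, y⟫_ℝ = r⁻¹ * ⟪d, y⟫_ℝ := fun y => by
    rw [he_def, real_inner_smul_left]
  have hcap' : ∀ x ∈ K, ℓ / r ≤ ⟪x, e⟫_ℝ → x - (2 * (⟪x, e⟫_ℝ - ℓ / r)) • e ∈ K := by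
    intro x hx hxe
    rw [hinner_e] at hxe
    have hℓ : ℓ ≤ ⟪x, d⟫_ℝ := by
      have h := mul_le_mul_of_nonneg_left hxe hr.le
      rwa [mul_div_cancel₀ _ hr.ne', ← mul_assoc, mul_inv_cancel₀ hr.ne', one_mul] at h
    have h := hcap x hx hℓ
    have heq : x - (2 * (⟪x, e⟫_ℝ - ℓ / r)) • e = x - (2 * (⟪x, d⟫_ℝ - ℓ) / N) • d := by
      rw [hinner_e, he_def, smul_smul, ← hrN]
      congr 2
      field_simp
    rw [heq]
    exact h
  have hδ' : 2 * (ℓ / r) * |⟪e, ν⟫_ℝ| ≤ δ := by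
    rw [hinner_e', abs_mul, abs_inv, abs_of_pos hr]
    have h : 2 * (ℓ / r) * (r⁻¹ * |⟪d, ν⟫_ℝ|) = 2 * ℓ * |⟪d, ν⟫_ℝ| / N := by
      rw [← hrN]
      field_simp
    rw [h]
    exact hδ
  have h := volume_inter_lt_reflect_le_of_cap hKc hK hKs he hcap' ν t hδ'
  have hvec : ν - (2 * ⟪e, ν⟫_ℝ) • e = ν - (2 * ⟪d, ν⟫_ℝ / N) • d := by
    rw [hinner_e', he_def, smul_smul, ← hrN]
    congr 2
    field_simp
  rw [hvec] at h
  exact h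

/-! ### The cap `{x₀ + x₁ − 2x₂ ≥ 1}` of the truncated octahedron reflects into it -/

/-- The linear arithmetic of the cap reflection: on the cube ∩ octahedron `|a|,|b|,|c| ≤ 2`,
`|a|+|b|+|c| ≤ 3`, with `a + b − 2c ≥ 1` and `λ = (a + b − 2c − 1)/3`, the point
`(a − λ, b − λ, c + 2λ)` is again in the cube ∩ octahedron. -/
theorem cap_reflect_arith {a b c : ℝ} (ha : |a| ≤ 2) (hb : |b| ≤ 2) (hc : |c| ≤ 2)
    (hs : |a| + |b| + |c| ≤ 3) (hL : 1 ≤ a + b - 2 * c) :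
    (|a - (a + b - 2 * c - 1) / 3| ≤ 2 ∧ |b - (a + b - 2 * c - 1) / 3| ≤ 2 ∧
      |c + 2 * ((a + b - 2 * c - 1) / 3)| ≤ 2) ∧
    |a - (a + b - 2 * c - 1) / 3| + |b - (a + b - 2 * c - 1) / 3| +
      |c + 2 * ((a + b - 2 * c - 1) / 3)| ≤ 3 := by
  have ha1 := le_abs_self a
  have ha2 := neg_abs_le a
  have hb1 := le_abs_self b
  have hb2 := neg_abs_le b
  have hc1 := le_abs_self c
  have hc2 := neg_abs_le c
  refine ⟨⟨abs_le.2 ⟨by linarith, by linarith⟩, abs_le.2 ⟨by linarith, by linarith⟩,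
    abs_le.2 ⟨by linarith, by linarith⟩⟩, ?_⟩
  rcases le_total 0 (a - (a + b - 2 * c - 1) / 3) with h₁ | h₁ <;>
  rcases le_total 0 (b - (a + b - 2 * c - 1) / 3) with h₂ | h₂ <;>
  rcases le_total 0 (c + 2 * ((a + b - 2 * c - 1) / 3)) with h₃ | h₃ <;>
  simp only [abs_of_nonneg, abs_of_nonpos, h₁, h₂, h₃] <;>
  linarith

/-- Inner products with the cubic `⟨111⟩` and `⟨112⟩` vectors, in coordinates. -/
theorem inner_cubic_vectors (y : E3) :
    ⟪(!₂[(1 : ℝ), 1, 1] : E3), y⟫_ℝ = y 0 + y 1 + y 2 ∧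
    ⟪(!₂[(1 : ℝ), 1, -2] : E3), y⟫_ℝ = y 0 + y 1 - 2 * y 2 ∧
    ⟪(!₂[(1 : ℝ), -2, 1] : E3), y⟫_ℝ = y 0 - 2 * y 1 + y 2 ∧
    ⟪(!₂[(-2 : ℝ), 1, 1] : E3), y⟫_ℝ = -2 * y 0 + y 1 + y 2 := by
  refine ⟨?_, ?_, ?_, ?_⟩ <;> simp [PiLp.inner_apply, Fin.sum_univ_three] <;> ring

/-- Squared norms of the cubic `⟨111⟩` and `⟨112⟩` vectors. -/
theorem norm_sq_cubic_vectors :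
    ‖(!₂[(1 : ℝ), 1, 1] : E3)‖ ^ 2 = 3 ∧ ‖(!₂[(1 : ℝ), 1, -2] : E3)‖ ^ 2 = 6 ∧
    ‖(!₂[(1 : ℝ), -2, 1] : E3)‖ ^ 2 = 6 ∧ ‖(!₂[(-2 : ℝ), 1, 1] : E3)‖ ^ 2 = 6 := by
  refine ⟨?_, ?_, ?_, ?_⟩ <;>
  · rw [PiLp.norm_sq_eq_of_L2]
    simp [Fin.sum_univ_three]
    norm_num

/-- **Cap reflection, zone `2`**: the cap `W ∩ {x₀ + x₁ − 2x₂ ≥ 1}` of the truncated octahedron,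
reflected across its base plane, lies in `W`. -/
theorem cap_reflect_mem_fccWulffBody₂ {x : E3} (hx : x ∈ fccWulffBody)
    (h1 : 1 ≤ ⟪x, (!₂[(1 : ℝ), 1, -2] : E3)⟫_ℝ) :
    x - (2 * (⟪x, (!₂[(1 : ℝ), 1, -2] : E3)⟫_ℝ - 1) / 6) • (!₂[(1 : ℝ), 1, -2] : E3) ∈ fccWulffBody := by
  have hin : ⟪x, (!₂[(1 : ℝ), 1, -2] : E3)⟫_ℝ = x 0 + x 1 - 2 * x 2 := by
    rw [real_inner_comm]; exact (inner_cubic_vectors x).2.1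
  rw [hin] at h1 ⊢
  rw [mem_fccWulffBody_iff] at hx ⊢
  obtain ⟨hxi, hxs⟩ := hx
  rw [Fin.sum_univ_three] at hxs
  obtain ⟨⟨h0, h1', h2⟩, hsum⟩ := cap_reflect_arith (hxi 0) (hxi 1) (hxi 2) hxs h1
  have hlam : 2 * (x 0 + x 1 - 2 * x 2 - 1) / 6 = (x 0 + x 1 - 2 * x 2 - 1) / 3 := by ring
  have hc0 : (x - (2 * (x 0 + x 1 - 2 * x 2 - 1) / 6) • (!₂[(1 : ℝ), 1, -2] : E3)) 0 =
      x 0 - (x 0 + x 1 - 2 * x 2 - 1) / 3 := by rw [hlam]; simp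
  have hc1 : (x - (2 * (x 0 + x 1 - 2 * x 2 - 1) / 6) • (!₂[(1 : ℝ), 1, -2] : E3)) 1 =
      x 1 - (x 0 + x 1 - 2 * x 2 - 1) / 3 := by rw [hlam]; simp
  have hc2 : (x - (2 * (x 0 + x 1 - 2 * x 2 - 1) / 6) • (!₂[(1 : ℝ), 1, -2] : E3)) 2 =
      x 2 + 2 * ((x 0 + x 1 - 2 * x 2 - 1) / 3) := by rw [hlam]; simp; ring
  refine ⟨fun i => ?_, ?_⟩
  · fin_cases i
    · exact hc0 ▸ h0
    · exact hc1 ▸ h1'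
    · exact hc2 ▸ h2
  · rw [Fin.sum_univ_three, hc0, hc1, hc2]
    exact hsum

/-- **Cap reflection, zone `1`** (`d = (1,−2,1)`). -/
theorem cap_reflect_mem_fccWulffBody₁ {x : E3} (hx : x ∈ fccWulffBody)
    (h1 : 1 ≤ ⟪x, (!₂[(1 : ℝ), -2, 1] : E3)⟫_ℝ) :
    x - (2 * (⟪x, (!₂[(1 : ℝ), -2, 1] : E3)⟫_ℝ - 1) / 6) • (!₂[(1 : ℝ), -2, 1] : E3) ∈ fccWulffBody := by
  have hin : ⟪x, (!₂[(1 : ℝ), -2, 1] : E3)⟫_ℝ = x 0 - 2 * x 1 + x 2 := by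
    rw [real_inner_comm]; exact (inner_cubic_vectors x).2.2.1
  rw [hin] at h1 ⊢
  rw [mem_fccWulffBody_iff] at hx ⊢
  obtain ⟨hxi, hxs⟩ := hx
  rw [Fin.sum_univ_three] at hxs
  have hxs' : |x 0| + |x 2| + |x 1| ≤ 3 := by linarith
  have h1x : 1 ≤ x 0 + x 2 - 2 * x 1 := by linarith
  obtain ⟨⟨h0, h2, h1'⟩, hsum⟩ := cap_reflect_arith (hxi 0) (hxi 2) (hxi 1) hxs' h1x
  have hlam : 2 * (x 0 - 2 * x 1 + x 2 - 1) / 6 = (x 0 + x 2 - 2 * x 1 - 1) / 3 := by ring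
  have hc0 : (x - (2 * (x 0 - 2 * x 1 + x 2 - 1) / 6) • (!₂[(1 : ℝ), -2, 1] : E3)) 0 =
      x 0 - (x 0 + x 2 - 2 * x 1 - 1) / 3 := by rw [hlam]; simp
  have hc1 : (x - (2 * (x 0 - 2 * x 1 + x 2 - 1) / 6) • (!₂[(1 : ℝ), -2, 1] : E3)) 1 =
      x 1 + 2 * ((x 0 + x 2 - 2 * x 1 - 1) / 3) := by rw [hlam]; simp; ring
  have hc2 : (x - (2 * (x 0 - 2 * x 1 + x 2 - 1) / 6) • (!₂[(1 : ℝ), -2, 1] : E3)) 2 =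
      x 2 - (x 0 + x 2 - 2 * x 1 - 1) / 3 := by rw [hlam]; simp
  refine ⟨fun i => ?_, ?_⟩
  · fin_cases i
    · exact hc0 ▸ h0
    · exact hc1 ▸ h1'
    · exact hc2 ▸ h2
  · rw [Fin.sum_univ_three, hc0, hc1, hc2]
    linarith

/-- **Cap reflection, zone `0`** (`d = (−2,1,1)`). -/
theorem cap_reflect_mem_fccWulffBody₀ {x : E3} (hx : x ∈ fccWulffBody)
    (h1 : 1 ≤ ⟪x, (!₂[(-2 : ℝ), 1, 1] : E3)⟫_ℝ) :
    x - (2 * (⟪x, (!₂[(-2 : ℝ), 1, 1] : E3)⟫_ℝ - 1) / 6) • (!₂[(-2 : ℝ), 1, 1] : E3) ∈ fccWulffBody := by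
  have hin : ⟪x, (!₂[(-2 : ℝ), 1, 1] : E3)⟫_ℝ = -2 * x 0 + x 1 + x 2 := by
    rw [real_inner_comm]; exact (inner_cubic_vectors x).2.2.2
  rw [hin] at h1 ⊢
  rw [mem_fccWulffBody_iff] at hx ⊢
  obtain ⟨hxi, hxs⟩ := hx
  rw [Fin.sum_univ_three] at hxs
  have hxs' : |x 1| + |x 2| + |x 0| ≤ 3 := by linarith
  have h1x : 1 ≤ x 1 + x 2 - 2 * x 0 := by linarith
  obtain ⟨⟨h1', h2, h0⟩, hsum⟩ := cap_reflect_arith (hxi 1) (hxi 2) (hxi 0) hxs' h1x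
  have hlam : 2 * (-2 * x 0 + x 1 + x 2 - 1) / 6 = (x 1 + x 2 - 2 * x 0 - 1) / 3 := by ring
  have hc0 : (x - (2 * (-2 * x 0 + x 1 + x 2 - 1) / 6) • (!₂[(-2 : ℝ), 1, 1] : E3)) 0 =
      x 0 + 2 * ((x 1 + x 2 - 2 * x 0 - 1) / 3) := by rw [hlam]; simp; ring
  have hc1 : (x - (2 * (-2 * x 0 + x 1 + x 2 - 1) / 6) • (!₂[(-2 : ℝ), 1, 1] : E3)) 1 =
      x 1 - (x 1 + x 2 - 2 * x 0 - 1) / 3 := by rw [hlam]; simp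
  have hc2 : (x - (2 * (-2 * x 0 + x 1 + x 2 - 1) / 6) • (!₂[(-2 : ℝ), 1, 1] : E3)) 2 =
      x 2 - (x 1 + x 2 - 2 * x 0 - 1) / 3 := by rw [hlam]; simp
  refine ⟨fun i => ?_, ?_⟩
  · fin_cases i
    · exact hc0 ▸ h0
    · exact hc1 ▸ h1'
    · exact hc2 ▸ h2
  · rw [Fin.sum_univ_three, hc0, hc1, hc2]
    linarith

end Summit.Ventures.Crystal3D.Theorems

end
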